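import Literature.NumberTheory.Automorphic.UnitaryGroupBorelLatticeCellCountSiegel
import Literature.NumberTheory.Automorphic.UnitaryGroupTruncatedKernelCellBound
import Literature.NumberTheory.Automorphic.UnitaryGroupCuspIntegralSiegelMajorant
import HarnessLib

/-!
# The Siegel-set estimate of `‖K(g,g) − K_B(g,g)‖` on `U(3)`: count times oscillation,
# `‖K(bk,bk) − K_B(bk,bk)‖ ≤ C · δ_B(b) · ε(bk)` high in the cusp
(Rogawski, *Automorphic Representations of Unitary Groups in Three Variables* (1990), §2.2, p. 13;
Arthur, *A trace formula for reductive groups I*, Duke Math. J. 45 (1978), §8: the rank-one estimate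
of the modified kernel on a Siegel set)

Topic `NumberTheory/Automorphic`; namespace `Literature.NumberTheory.Automorphic.UnitaryGroup`. THEOREMS
ONLY over accepted tree modules: no definition, no named fact, no instance, no notation, no `sorry`.
This is the POINTWISE half of the `hest` socket of ★ `exists_cover_setLIntegral_lt_top_of_majorant`
(`UnitaryGroupCuspIntegralSiegelMajorant`, row H8b of the T1-qs sub-line of the T1 engine line
`Cruxes/H413/Lines/F0_T1InnerFormTraceIdentity.lean`): it assembles

* ★ H3 `exists_finset_truncatedKernel` (`UnitaryGroupTruncatedKernelCellBound`): high in the cusp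
  `k^T(g) = K(g,g) − K_B(g,g)` and `‖k^T(g)‖ ≤ #R(g) · ε` whenever `‖f(x) − f(x · g⁻¹ug)‖ ≤ ε` (`u ∈ 𝓕`),
  `R(g)` the finite set of `β ∈ B(F)` with `g⁻¹ β (y g) ∈ supp f` for some `y ∈ {1} ∪ W₀`;
* ★ H4-d `exists_forall_card_mul_measure_le_mul_torusRootModulus`
  (`UnitaryGroupBorelLatticeCellCountSiegel`): `#R(bk) · ν(𝓕) ≤ C₀ · δ_B(b)` as long as the unipotent
  part of `b` stays in a compact `Ω` and the root values of its torus part in compacts `R₁, R₂`, `k` in a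
  compact `K`;

into THE SIEGEL ESTIMATE: there are `T₁ = max(1, c₀(f))` and `C = C₀ / ν(𝓕)` such that for `T > T₁`,
every such `b`, `k`, with `H(bk) > T`, and every modulus `ε` of right-oscillation of `f` along
`(bk)⁻¹ 𝓕 (bk)`,
  `‖K(bk,bk) − K_B(bk,bk)‖ₑ ≤ C · δ_B(b) · ε`.
The oscillation row (H5: `ε ≲ r(b)⁻¹` for quasi-split test functions) and the Siegel set of `B`
(H9: which `Ω, R₁, R₂` and which `S ⊆ B(𝔸)`) are the consumer's; here they enter only as hypotheses.

* §1 `exists_finset_enorm_kernel_sub_kernelBorel_le` — `‖K − K_B‖ₑ(g) ≤ #R(g) · ε` in `ℝ≥0∞`, with the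
  finite set `R(g)` in the shape ★ H4-d consumes (`y ∈ insert 1 W₀ ⊆ N(𝔸_F)`).
* §2 **`exists_forall_enorm_kernel_sub_kernelBorel_le_mul_torusRootModulus`** — THE SIEGEL ESTIMATE for a
  compact set `K ⊆ G(𝔸_F)` of right factors, hypothesis `T < H(bk)`.
* §3 `exists_forall_enorm_kernel_sub_kernelBorel_le_mul_torusRootModulus_maximalCompact` — the same at
  `K := K_U = adelicVal⁻¹(K_∞ · GL₃(𝒪̂_E))` (★ `isCompact_comap_adelicVal_standardMaximalCompactGL`), with
  the hypothesis `T < H(b)` of the `hest` socket (★ `borelHeight_mul_of_mem_comap_standardMaximalCompactGL`).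
* §4 `exists_forall_enorm_kernel_sub_kernelBorel_le_of_oscillation` — the `hest`-shaped packaging: for
  any `S ⊆ B(𝔸_F)` on which the three memberships hold and any oscillation majorant `ρ : B(𝔸_F) → ℝ≥0`
  of `f` along `(bk)⁻¹ 𝓕 (bk)` (`b ∈ S`, `k ∈ K_U`), the function `Φ(b) = C · δ_B(b) · ρ(b)` satisfies
  `hest` LITERALLY.
* §5 `exists_forall_enorm_kernel_sub_kernelBorel_le_of_oscillation'` — the same for the `K_B` of an
  ARBITRARY pair `(ν, 𝓕)` (★ `kernelBorel_eq_of_isFundamentalDomain`), the oscillation being measured over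
  a bounded fundamental domain `𝓕'`.

## References

* J. D. Rogawski, *Automorphic Representations of Unitary Groups in Three Variables*, Annals of
  Mathematics Studies 123 (1990), §2.2 (p. 13) [Rogawski1990].
* J. Arthur, *A trace formula for reductive groups I: terms associated to classes in `G(ℚ)`*, Duke
  Math. J. 45 (1978), §8 (pp. 947–950) [Arthur1978TraceFormulaI].
-/

set_option autoImplicit false

noncomputable section

open MeasureTheory Measure NumberField IsDedekindDomain Set
open scoped NNReal ENNReal Pointwise

namespace Literature.NumberTheory.Automorphic

namespace UnitaryGroup

variable {F E : Type} [Field F] [NumberField F] [Field E] [NumberField E] [Algebra F E]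
  {c : E ≃ₐ[F] E}

section Three

variable [MeasurableSpace (adelicUnipotent F E c 3)] [BorelSpace (adelicUnipotent F E c 3)]

/-! ## §1 `‖K − K_B‖ₑ(g) ≤ #R(g) · ε` high in the cusp -/

/-- **`‖K(g,g) − K_B(g,g)‖ₑ ≤ #R(g) · ε` high in the cusp.** For a Haar measure `ν` of `N(𝔸_F)`, a
fundamental domain `𝓕` of `N(F)` inside a compact `W₀`, `f ∈ C_c(U(J₃)(𝔸_F))`, `1 ≤ T < H(g)` and
`K(g,g) = Σ_{β ∈ B(F)} f(g⁻¹βg)`: there is a finite `R ⊆ B(F)`, each `β ∈ R` having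
`g⁻¹ β (y g) ∈ supp f` for some `y ∈ {1} ∪ W₀ ⊆ N(𝔸_F)`, with `‖K(g,g) − K_B(g,g)‖ₑ ≤ #R · ε` for every
`ε` bounding the right-oscillation `‖f(x) − f(x · g⁻¹ u g)‖` (`u ∈ 𝓕`) — ★ `exists_finset_truncatedKernel`
read through ★ `truncatedKernel_eq_kernel_sub_kernelBorel` (`k^T = K − K_B` for `1 ≤ T < H(g)`).
[cite: Rogawski1990, §2.2 (p. 13)] -/
theorem exists_finset_enorm_kernel_sub_kernelBorel_le (ν : Measure (adelicUnipotent F E c 3))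
    [ν.IsHaarMeasure] {𝓕 W₀ : Set (adelicUnipotent F E c 3)}
    (h𝓕 : IsFundamentalDomain (rationalUnipotent F E c 3) 𝓕 ν) (hW₀ : IsCompact W₀) (h𝓕W₀ : 𝓕 ⊆ W₀)
    {f : (quasiSplit F E c 3).Adelic → ℂ} (hfc : Continuous f) (hf : HasCompactSupport f)
    {T : ℝ≥0} (hT : 1 ≤ T) {g : (quasiSplit F E c 3).Adelic} (hg : T < borelHeight g)
    (hK : kernel f g g = borelSum f g g) :
    ∃ R : Finset (arithmeticBorel F E c 3),
      (∀ β ∈ R, ∃ y ∈ insert (1 : adelicUnipotent F E c 3) W₀,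
        g⁻¹ * (((β : (quasiSplit F E c 3).arithmeticSubgroup)) : (quasiSplit F E c 3).Adelic) *
          (((y : adelicUnipotent F E c 3) : (quasiSplit F E c 3).Adelic) * g) ∈ tsupport f) ∧
      ∀ ε : ℝ, (∀ x : (quasiSplit F E c 3).Adelic, ∀ u ∈ 𝓕,
        ‖f x - f (x * (g⁻¹ * (u : (quasiSplit F E c 3).Adelic) * g))‖ ≤ ε) →
        (‖kernel f g g - kernelBorel ν 𝓕 f g g‖ₑ : ℝ≥0∞) ≤ (R.card : ℝ≥0∞) * ENNReal.ofReal ε := by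
  obtain ⟨R, hR, -, hbound⟩ := exists_finset_truncatedKernel ν h𝓕 hW₀ h𝓕W₀ hfc hf hT hg hK
  refine ⟨R, fun β hβ => ?_, fun ε hω => ?_⟩
  · obtain ⟨y, hy, hmem⟩ := hR β hβ
    rcases Set.mem_insert_iff.1 hy with rfl | ⟨u, hu, rfl⟩
    · exact ⟨1, Set.mem_insert _ _, by rwa [OneMemClass.coe_one]⟩
    · exact ⟨u, Set.mem_insert_of_mem _ hu, hmem⟩
  · have h := hbound ε hω
    rw [truncatedKernel_eq_kernel_sub_kernelBorel ν h𝓕 f hT hg] at h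
    calc (‖kernel f g g - kernelBorel ν 𝓕 f g g‖ₑ : ℝ≥0∞)
        = ENNReal.ofReal ‖kernel f g g - kernelBorel ν 𝓕 f g g‖ := (ofReal_norm _).symm
      _ ≤ ENNReal.ofReal ((R.card : ℝ) * ε) := ENNReal.ofReal_le_ofReal h
      _ = (R.card : ℝ≥0∞) * ENNReal.ofReal ε := by
          rw [ENNReal.ofReal_mul (Nat.cast_nonneg _), ENNReal.ofReal_natCast]

/-! ## §2 The Siegel estimate: count times oscillation -/

/-- **THE SIEGEL ESTIMATE `‖K(bk,bk) − K_B(bk,bk)‖ₑ ≤ C · δ_B(b) · ε`.** Let `ν` be a Haar measure of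
`N(𝔸_F)` (`N = 3`), `𝓕` a fundamental domain of `N(F)` inside a compact `W₀`, `f ∈ C_c(U(J₃)(𝔸_F))`,
`K, Ω ⊆ G(𝔸_F)` and `R₁, R₂ ⊆ 𝔸_E` compact. There are `T₁` (`= max(1, c₀(f))`, ★
`exists_kernel_eq_borelSum_of_lt_borelHeight`) and `C : ℝ≥0` (`= C₀ / ν(𝓕)`, ★
`exists_forall_card_mul_measure_le_mul_torusRootModulus`) such that for every `T > T₁`, every
`b ∈ B(𝔸_F)` with unipotent part `(torusPart b)⁻¹ b ∈ Ω` and root values `d₀⁻¹d₁ ∈ R₁`, `d₀⁻¹d₂ ∈ R₂`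
(`d = diagUnit b`), every `k ∈ K` with `H(bk) > T`, and every `ε` with `‖f(x) − f(x · (bk)⁻¹ u (bk))‖ ≤ ε`
(`x ∈ G(𝔸_F)`, `u ∈ 𝓕`): `‖K(bk,bk) − K_B(bk,bk)‖ₑ ≤ C · δ_B(b) · ε`, `δ_B(b) = torusRootModulus E 3 d`
(Arthur (1978), §8; Rogawski (1990), §2.2 p. 13: `|k^T| ≲ δ_B · ω_f` on the Siegel set).
[cite: Rogawski1990, §2.2 (p. 13)] [cite: Arthur1978TraceFormulaI, §8 (pp. 947–950)] -/
theorem exists_forall_enorm_kernel_sub_kernelBorel_le_mul_torusRootModulus (hc : c * c = 1)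
    (hc1 : c ≠ 1) (ν : Measure (adelicUnipotent F E c 3)) [ν.IsHaarMeasure]
    {𝓕 : Set (adelicUnipotent F E c 3)} (h𝓕 : IsFundamentalDomain (rationalUnipotent F E c 3) 𝓕 ν)
    {W₀ : Set (adelicUnipotent F E c 3)} (hW₀ : IsCompact W₀) (h𝓕W₀ : 𝓕 ⊆ W₀)
    {f : (quasiSplit F E c 3).Adelic → ℂ} (hfc : Continuous f) (hf : HasCompactSupport f)
    {K : Set (quasiSplit F E c 3).Adelic} (hK : IsCompact K)
    {Ω : Set (quasiSplit F E c 3).Adelic} (hΩ : IsCompact Ω)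
    {R₁ R₂ : Set (AdeleRing (𝓞 E) E)} (hR₁ : IsCompact R₁) (hR₂ : IsCompact R₂) :
    ∃ T₁ : ℝ≥0, ∃ C : ℝ≥0, ∀ T : ℝ≥0, T₁ < T → ∀ b : borelAdelic F E c 3,
      (((torusPart b)⁻¹ * b : borelAdelic F E c 3) : (quasiSplit F E c 3).Adelic) ∈ Ω →
      (((diagUnit b.2 0)⁻¹ * diagUnit b.2 1 : (AdeleRing (𝓞 E) E)ˣ) : AdeleRing (𝓞 E) E) ∈ R₁ →
      (((diagUnit b.2 0)⁻¹ * diagUnit b.2 2 : (AdeleRing (𝓞 E) E)ˣ) : AdeleRing (𝓞 E) E) ∈ R₂ →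
      ∀ k ∈ K, T < borelHeight ((b : (quasiSplit F E c 3).Adelic) * k) →
      ∀ ε : ℝ, (∀ x : (quasiSplit F E c 3).Adelic, ∀ u ∈ 𝓕,
        ‖f x - f (x * (((b : (quasiSplit F E c 3).Adelic) * k)⁻¹ * (u : (quasiSplit F E c 3).Adelic) *
          ((b : (quasiSplit F E c 3).Adelic) * k)))‖ ≤ ε) →
      (‖kernel f ((b : (quasiSplit F E c 3).Adelic) * k) ((b : (quasiSplit F E c 3).Adelic) * k) -
          kernelBorel ν 𝓕 f ((b : (quasiSplit F E c 3).Adelic) * k)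
            ((b : (quasiSplit F E c 3).Adelic) * k)‖ₑ : ℝ≥0∞) ≤
        (C : ℝ≥0∞) * ((torusRootModulus E 3 (diagUnit b.2) : ℝ≥0) : ℝ≥0∞) * ENNReal.ofReal ε := by
  -- `K = Σ_{B(F)}` above `c₀(f)`; the count constant `C₀`; `ν(𝓕) ∈ (0, ∞)`
  obtain ⟨c₀, hc₀⟩ := exists_kernel_eq_borelSum_of_lt_borelHeight (c := c) hf
  obtain ⟨C₀, hC₀⟩ := exists_forall_card_mul_measure_le_mul_torusRootModulus hc hc1 ν h𝓕 hW₀ h𝓕W₀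
    (hW₀.insert 1) (C := tsupport f) hf hK hΩ hR₁ hR₂
  have h0 : ν 𝓕 ≠ 0 := measure_ne_zero_of_isFundamentalDomain ν h𝓕
  have htop : ν 𝓕 ≠ ∞ := ((measure_mono h𝓕W₀).trans_lt hW₀.measure_lt_top).ne
  refine ⟨max 1 c₀, C₀ / (ν 𝓕).toNNReal, fun T hT b hΩb h₁ h₂ k hk hg ε hω => ?_⟩
  have hT1 : 1 ≤ T := le_of_lt (lt_of_le_of_lt (le_max_left _ _) hT)
  have hgc : c₀ < borelHeight ((b : (quasiSplit F E c 3).Adelic) * k) :=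
    lt_trans (lt_of_le_of_lt (le_max_right _ _) hT) hg
  obtain ⟨R, hR, hbound⟩ := exists_finset_enorm_kernel_sub_kernelBorel_le ν h𝓕 hW₀ h𝓕W₀ hfc hf hT1 hg
    (hc₀ _ hgc)
  -- the count `#R · ν(𝓕) ≤ C₀ · δ_B(b)`
  have hcount := hC₀ b hΩb h₁ h₂ k hk R hR
  have hcard : (R.card : ℝ≥0∞) ≤ ((C₀ / (ν 𝓕).toNNReal : ℝ≥0) : ℝ≥0∞) *
      ((torusRootModulus E 3 (diagUnit b.2) : ℝ≥0) : ℝ≥0∞) := by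
    have hν : (((ν 𝓕).toNNReal : ℝ≥0) : ℝ≥0∞) = ν 𝓕 := ENNReal.coe_toNNReal htop
    have hν0 : (ν 𝓕).toNNReal ≠ 0 := fun h => h0 (by rw [← hν, h, ENNReal.coe_zero])
    rw [ENNReal.coe_div hν0, hν, div_eq_mul_inv, mul_right_comm, ← div_eq_mul_inv]
    exact (ENNReal.le_div_iff_mul_le (Or.inl h0) (Or.inl htop)).2 hcount
  calc (‖kernel f ((b : (quasiSplit F E c 3).Adelic) * k) ((b : (quasiSplit F E c 3).Adelic) * k) -
          kernelBorel ν 𝓕 f ((b : (quasiSplit F E c 3).Adelic) * k)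
            ((b : (quasiSplit F E c 3).Adelic) * k)‖ₑ : ℝ≥0∞)
      ≤ (R.card : ℝ≥0∞) * ENNReal.ofReal ε := hbound ε hω
    _ ≤ _ := mul_le_mul' hcard le_rfl

/-! ## §3 At the standard maximal compact `K_U = adelicVal⁻¹(K_∞ · GL₃(𝒪̂_E))` -/

/-- **THE SIEGEL ESTIMATE AT `K := K_U`**, in the letters of the `hest` socket of ★
`exists_cover_setLIntegral_lt_top_of_majorant_maximalCompact`: `k` with `adelicVal k ∈ K_∞ · GL₃(𝒪̂_E)`
(compact trace ★ `isCompact_comap_adelicVal_standardMaximalCompactGL`) and the height hypothesis on `b`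
itself (`H(bk) = H(b)`, ★ `borelHeight_mul_of_mem_comap_standardMaximalCompactGL`).
[cite: Rogawski1990, §2.2 (p. 13)] [cite: Arthur1978TraceFormulaI, §8 (pp. 947–950)] -/
theorem exists_forall_enorm_kernel_sub_kernelBorel_le_mul_torusRootModulus_maximalCompact
    (hc : c * c = 1) (hc1 : c ≠ 1) (ν : Measure (adelicUnipotent F E c 3)) [ν.IsHaarMeasure]
    {𝓕 : Set (adelicUnipotent F E c 3)} (h𝓕 : IsFundamentalDomain (rationalUnipotent F E c 3) 𝓕 ν)
    {W₀ : Set (adelicUnipotent F E c 3)} (hW₀ : IsCompact W₀) (h𝓕W₀ : 𝓕 ⊆ W₀)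
    {f : (quasiSplit F E c 3).Adelic → ℂ} (hfc : Continuous f) (hf : HasCompactSupport f)
    {Ω : Set (quasiSplit F E c 3).Adelic} (hΩ : IsCompact Ω)
    {R₁ R₂ : Set (AdeleRing (𝓞 E) E)} (hR₁ : IsCompact R₁) (hR₂ : IsCompact R₂) :
    ∃ T₁ : ℝ≥0, ∃ C : ℝ≥0, ∀ T : ℝ≥0, T₁ < T → ∀ b : borelAdelic F E c 3,
      (((torusPart b)⁻¹ * b : borelAdelic F E c 3) : (quasiSplit F E c 3).Adelic) ∈ Ω →
      (((diagUnit b.2 0)⁻¹ * diagUnit b.2 1 : (AdeleRing (𝓞 E) E)ˣ) : AdeleRing (𝓞 E) E) ∈ R₁ →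
      (((diagUnit b.2 0)⁻¹ * diagUnit b.2 2 : (AdeleRing (𝓞 E) E)ˣ) : AdeleRing (𝓞 E) E) ∈ R₂ →
      ∀ k : (quasiSplit F E c 3).Adelic,
        adelicVal F E c 3 ((StdForm.antidiagonal 3).over E) k ∈ standardMaximalCompactGL 3 E →
        T < borelHeight (b : (quasiSplit F E c 3).Adelic) →
      ∀ ε : ℝ, (∀ x : (quasiSplit F E c 3).Adelic, ∀ u ∈ 𝓕,
        ‖f x - f (x * (((b : (quasiSplit F E c 3).Adelic) * k)⁻¹ * (u : (quasiSplit F E c 3).Adelic) *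
          ((b : (quasiSplit F E c 3).Adelic) * k)))‖ ≤ ε) →
      (‖kernel f ((b : (quasiSplit F E c 3).Adelic) * k) ((b : (quasiSplit F E c 3).Adelic) * k) -
          kernelBorel ν 𝓕 f ((b : (quasiSplit F E c 3).Adelic) * k)
            ((b : (quasiSplit F E c 3).Adelic) * k)‖ₑ : ℝ≥0∞) ≤
        (C : ℝ≥0∞) * ((torusRootModulus E 3 (diagUnit b.2) : ℝ≥0) : ℝ≥0∞) * ENNReal.ofReal ε := by
  obtain ⟨T₁, C, h⟩ := exists_forall_enorm_kernel_sub_kernelBorel_le_mul_torusRootModulus hc hc1 ν h𝓕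
    hW₀ h𝓕W₀ hfc hf (isCompact_comap_adelicVal_standardMaximalCompactGL (F := F) (E := E) (c := c) (N := 3))
    hΩ hR₁ hR₂
  refine ⟨T₁, C, fun T hT b hΩb h₁ h₂ k hk hb ε hω => h T hT b hΩb h₁ h₂ k (Subgroup.mem_comap.2 hk) ?_ ε hω⟩
  rwa [borelHeight_mul_of_mem_comap_standardMaximalCompactGL (Subgroup.mem_comap.2 hk)]

/-! ## §4 The `hest` socket from an oscillation majorant -/

/-- **THE `hest` SOCKET FROM AN OSCILLATION MAJORANT.** Let `S ⊆ B(𝔸_F)` be any set on which the unipotent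
parts lie in a compact `Ω` and the root values in compacts `R₁, R₂` (a Siegel set of `B`, row H9). There are
`T₁` and `C : ℝ≥0` such that for every `T > T₁` and every `ρ : B(𝔸_F) → ℝ≥0` bounding the right-oscillation
of `f` along `(bk)⁻¹ 𝓕 (bk)` for `b ∈ S`, `k ∈ K_U`, `H(b) > T` (row H5), the function
`Φ(b) := C · δ_B(b) · ρ(b)` satisfies the hypothesis `hest` of ★
`exists_cover_setLIntegral_lt_top_of_majorant_maximalCompact` LITERALLY:
`‖K(bk,bk) − K_B(bk,bk)‖ₑ ≤ Φ(b)` for `b ∈ S`, `adelicVal k ∈ K_∞ · GL₃(𝒪̂_E)`, `T < H(b)`.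
[cite: Rogawski1990, §2.2 (p. 13)] [cite: Arthur1978TraceFormulaI, §8 (pp. 947–950)] -/
theorem exists_forall_enorm_kernel_sub_kernelBorel_le_of_oscillation (hc : c * c = 1) (hc1 : c ≠ 1)
    (ν : Measure (adelicUnipotent F E c 3)) [ν.IsHaarMeasure]
    {𝓕 : Set (adelicUnipotent F E c 3)} (h𝓕 : IsFundamentalDomain (rationalUnipotent F E c 3) 𝓕 ν)
    {W₀ : Set (adelicUnipotent F E c 3)} (hW₀ : IsCompact W₀) (h𝓕W₀ : 𝓕 ⊆ W₀)
    {f : (quasiSplit F E c 3).Adelic → ℂ} (hfc : Continuous f) (hf : HasCompactSupport f)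
    {Ω : Set (quasiSplit F E c 3).Adelic} (hΩ : IsCompact Ω)
    {R₁ R₂ : Set (AdeleRing (𝓞 E) E)} (hR₁ : IsCompact R₁) (hR₂ : IsCompact R₂)
    {S : Set (borelAdelic F E c 3)}
    (hSΩ : ∀ b ∈ S, (((torusPart b)⁻¹ * b : borelAdelic F E c 3) : (quasiSplit F E c 3).Adelic) ∈ Ω)
    (hS₁ : ∀ b ∈ S,
      (((diagUnit b.2 0)⁻¹ * diagUnit b.2 1 : (AdeleRing (𝓞 E) E)ˣ) : AdeleRing (𝓞 E) E) ∈ R₁)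
    (hS₂ : ∀ b ∈ S,
      (((diagUnit b.2 0)⁻¹ * diagUnit b.2 2 : (AdeleRing (𝓞 E) E)ˣ) : AdeleRing (𝓞 E) E) ∈ R₂) :
    ∃ T₁ : ℝ≥0, ∃ C : ℝ≥0, ∀ T : ℝ≥0, T₁ < T → ∀ ρ : borelAdelic F E c 3 → ℝ≥0,
      (∀ b ∈ S, ∀ k : (quasiSplit F E c 3).Adelic,
        adelicVal F E c 3 ((StdForm.antidiagonal 3).over E) k ∈ standardMaximalCompactGL 3 E →
        T < borelHeight (b : (quasiSplit F E c 3).Adelic) →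
        ∀ x : (quasiSplit F E c 3).Adelic, ∀ u ∈ 𝓕,
          ‖f x - f (x * (((b : (quasiSplit F E c 3).Adelic) * k)⁻¹ * (u : (quasiSplit F E c 3).Adelic) *
            ((b : (quasiSplit F E c 3).Adelic) * k)))‖ ≤ (ρ b : ℝ)) →
      ∀ b ∈ S, ∀ k : (quasiSplit F E c 3).Adelic,
        adelicVal F E c 3 ((StdForm.antidiagonal 3).over E) k ∈ standardMaximalCompactGL 3 E →
        T < borelHeight (b : (quasiSplit F E c 3).Adelic) →
        (‖kernel f ((b : (quasiSplit F E c 3).Adelic) * k) ((b : (quasiSplit F E c 3).Adelic) * k) -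
            kernelBorel ν 𝓕 f ((b : (quasiSplit F E c 3).Adelic) * k)
              ((b : (quasiSplit F E c 3).Adelic) * k)‖ₑ : ℝ≥0∞) ≤
          (C : ℝ≥0∞) * ((torusRootModulus E 3 (diagUnit b.2) : ℝ≥0) : ℝ≥0∞) * ((ρ b : ℝ≥0) : ℝ≥0∞) := by
  obtain ⟨T₁, C, h⟩ := exists_forall_enorm_kernel_sub_kernelBorel_le_mul_torusRootModulus_maximalCompact
    hc hc1 ν h𝓕 hW₀ h𝓕W₀ hfc hf hΩ hR₁ hR₂
  refine ⟨T₁, C, fun T hT ρ hρ b hb k hk hTb => ?_⟩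
  have := h T hT b (hSΩ b hb) (hS₁ b hb) (hS₂ b hb) k hk hTb (ρ b : ℝ) (hρ b hb k hk hTb)
  rwa [ENNReal.ofReal_coe_nnreal] at this

/-! ## §5 The same for an ARBITRARY pair `(ν, 𝓕)` (`K_B` does not depend on it) -/

/-- **THE `hest` SOCKET FOR EVERY `(ν, 𝓕)`.** The Borel kernel `K_B = kernelBorel ν 𝓕 f` does not depend
on the Haar measure `ν` and the fundamental domain `𝓕` of `N(F)` (★ `kernelBorel_eq_of_isFundamentalDomain`),
so the estimate of §4 — proved with the oscillation measured over a BOUNDED fundamental domain `𝓕' ⊆ W₀`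
(e.g. Tate's Heisenberg domain) — bounds `‖K(bk,bk) − K_B(bk,bk)‖ₑ` for the `K_B` of ANY pair `(ν, 𝓕)`, the
one quantified in the hypothesis `hmaj` of ★ `truncatedKernelIntegrable_of_majorant_maximalCompact`.
[cite: Rogawski1990, §2.2 (p. 13)] [cite: Arthur1978TraceFormulaI, §8 (pp. 947–950)] -/
theorem exists_forall_enorm_kernel_sub_kernelBorel_le_of_oscillation' (hc : c * c = 1) (hc1 : c ≠ 1)
    (ν : Measure (adelicUnipotent F E c 3)) [ν.IsHaarMeasure]
    {𝓕 : Set (adelicUnipotent F E c 3)} (h𝓕 : IsFundamentalDomain (rationalUnipotent F E c 3) 𝓕 ν)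
    (ν' : Measure (adelicUnipotent F E c 3)) [ν'.IsHaarMeasure]
    {𝓕' : Set (adelicUnipotent F E c 3)} (h𝓕' : IsFundamentalDomain (rationalUnipotent F E c 3) 𝓕' ν')
    {W₀ : Set (adelicUnipotent F E c 3)} (hW₀ : IsCompact W₀) (h𝓕'W₀ : 𝓕' ⊆ W₀)
    {f : (quasiSplit F E c 3).Adelic → ℂ} (hfc : Continuous f) (hf : HasCompactSupport f)
    {Ω : Set (quasiSplit F E c 3).Adelic} (hΩ : IsCompact Ω)
    {R₁ R₂ : Set (AdeleRing (𝓞 E) E)} (hR₁ : IsCompact R₁) (hR₂ : IsCompact R₂)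
    {S : Set (borelAdelic F E c 3)}
    (hSΩ : ∀ b ∈ S, (((torusPart b)⁻¹ * b : borelAdelic F E c 3) : (quasiSplit F E c 3).Adelic) ∈ Ω)
    (hS₁ : ∀ b ∈ S,
      (((diagUnit b.2 0)⁻¹ * diagUnit b.2 1 : (AdeleRing (𝓞 E) E)ˣ) : AdeleRing (𝓞 E) E) ∈ R₁)
    (hS₂ : ∀ b ∈ S,
      (((diagUnit b.2 0)⁻¹ * diagUnit b.2 2 : (AdeleRing (𝓞 E) E)ˣ) : AdeleRing (𝓞 E) E) ∈ R₂) :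
    ∃ T₁ : ℝ≥0, ∃ C : ℝ≥0, ∀ T : ℝ≥0, T₁ < T → ∀ ρ : borelAdelic F E c 3 → ℝ≥0,
      (∀ b ∈ S, ∀ k : (quasiSplit F E c 3).Adelic,
        adelicVal F E c 3 ((StdForm.antidiagonal 3).over E) k ∈ standardMaximalCompactGL 3 E →
        T < borelHeight (b : (quasiSplit F E c 3).Adelic) →
        ∀ x : (quasiSplit F E c 3).Adelic, ∀ u ∈ 𝓕',
          ‖f x - f (x * (((b : (quasiSplit F E c 3).Adelic) * k)⁻¹ * (u : (quasiSplit F E c 3).Adelic) *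
            ((b : (quasiSplit F E c 3).Adelic) * k)))‖ ≤ (ρ b : ℝ)) →
      ∀ b ∈ S, ∀ k : (quasiSplit F E c 3).Adelic,
        adelicVal F E c 3 ((StdForm.antidiagonal 3).over E) k ∈ standardMaximalCompactGL 3 E →
        T < borelHeight (b : (quasiSplit F E c 3).Adelic) →
        (‖kernel f ((b : (quasiSplit F E c 3).Adelic) * k) ((b : (quasiSplit F E c 3).Adelic) * k) -
            kernelBorel ν 𝓕 f ((b : (quasiSplit F E c 3).Adelic) * k)
              ((b : (quasiSplit F E c 3).Adelic) * k)‖ₑ : ℝ≥0∞) ≤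
          (C : ℝ≥0∞) * ((torusRootModulus E 3 (diagUnit b.2) : ℝ≥0) : ℝ≥0∞) * ((ρ b : ℝ≥0) : ℝ≥0∞) := by
  rw [kernelBorel_eq_of_isFundamentalDomain ν ν' h𝓕 h𝓕' f]
  exact exists_forall_enorm_kernel_sub_kernelBorel_le_of_oscillation hc hc1 ν' h𝓕' hW₀ h𝓕'W₀ hfc hf hΩ
    hR₁ hR₂ hSΩ hS₁ hS₂

end Three

end UnitaryGroup

end Literature.NumberTheory.Automorphic
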